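import Summits.KontsevichZagierPeriods.KontsevichZagierPeriods.Theorems.TerasomaMultiplicationBetaCancellationStubTriangleConst

/-!
# `BetaCancellation` (stmt-KontsevichZagierPeriods-13633) — line `dirichlet-companion-to-pi`, stub `stub_weightConst`

Helper file of the crux lead (`--supports` stmt-KontsevichZagierPeriods-13633), registered stub
`stub_weightConst` of the skeleton of the line `dirichlet-companion-to-pi` (π-cancellation for
certificates preserving the weight `w₁ (x) = (1 + x)√(1 - x²)` of the first disc coordinate). The
weighted closed unit disc `D_w = [{x² + y² ≤ 1}, (1 + x)√(1 - x²)]`, of dimension `2`, is worth the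
rational constant `8/3` against every factor `s = [σ, f]`: `s × D_w ∼ [σ, (8/3)·f]` in the
Kontsevich–Zagier calculus of `KZCalculus.lean`. The proof is the template `stub_triangleConst`
(`Theorems/TerasomaMultiplicationBetaCancellationStubTriangleConst.lean`) with the inscribed
triangle replaced by the weighted disc — two Newton–Leibniz moves (printed rule (3)) along the last
coordinate:

* in dimension `2 → 1`: `D_w ∼ [[-1, 1], 2(1 + x)(1 - x²)]` (base the segment `[-1, 1]`, edges
  `∓√(1 - x²)`, primitive `F (x, y) = y · (1 + x)√(1 - x²)`, boundary term
  `2√(1 - x²) · (1 + x)√(1 - x²) = 2(1 + x)(1 - x²)`), transported to the products with `s` by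
  the compatibility of `∼` with products (`KZ.Equivalent.prod`);
* in dimension `m + 1 → m`: `s × [[-1, 1], k] ∼ [σ, (P 1 - P (-1))·f]` with the kernel
  `k x = 2(1 + x)(1 - x²)`, its primitive `P x = 2(x + x²/2 - x³/3 - x⁴/4)`, constant edges
  `-1 ≤ 1`, primitive `f ⊗ P`, and `P 1 - P (-1) = 11/6 + 5/6 = 8/3`.

No definitions are introduced: the two moves are stated for arbitrary representations with the
prescribed domains and integrands (`D_w`, `[[-1, 1], k]`, `[[-1, 1], P]`), which the stub then
instantiates by anonymous constructors.

References: M. Kontsevich, D. Zagier, *Periods* (2001), §1.1 (eq. (1): `π = ∬_{x²+y²≤1} dx dy`),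
§1.2 (rules (1)–(3)).
-/

noncomputable section

-- `Summit.KontsevichZagierPeriods.KontsevichZagierPeriods.…` is the tree's mandated layout (single-conjunct summit).
set_option linter.dupNamespace false

namespace Summit.KontsevichZagierPeriods.KontsevichZagierPeriods.BetaCancellationLine

open Set MeasureTheory
open Literature.NumberTheory.Transcendental
open Literature.NumberTheory.Transcendental.KZ
open Literature.ModelTheory.ExponentialFields (IsSemialgebraic isSemialgebraic_setOf_eval_nonneg)
open MvPolynomial (aeval X C)
open Summit.KontsevichZagierPeriods.KontsevichZagierPeriods.BetaCancellationNegative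
  (natAdd_zero_eq_last init_eq_comp_castAdd)

/-! ## The kernel `k x = 2(1 + x)(1 - x²)` and its primitive -/

/-- `P' = k`: the primitive `P x = 2(x + x²/2 - x³/3 - x⁴/4)` of the kernel
`k x = 2(1 + x)(1 - x²)`. [folklore] -/
theorem weightConst_hasDerivAt_prim (t : ℝ) :
    HasDerivAt (fun t : ℝ => 2 * (t + t ^ 2 / 2 - t ^ 3 / 3 - t ^ 4 / 4))
      (2 * (1 + t) * (1 - t ^ 2)) t := by
  have h1 : HasDerivAt (fun t : ℝ => t) 1 t := hasDerivAt_id' t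
  have h2 : HasDerivAt (fun t : ℝ => t ^ 2 / 2) (((2 : ℕ) : ℝ) * t ^ (2 - 1) / 2) t :=
    (hasDerivAt_pow 2 t).div_const 2
  have h3 : HasDerivAt (fun t : ℝ => t ^ 3 / 3) (((3 : ℕ) : ℝ) * t ^ (3 - 1) / 3) t :=
    (hasDerivAt_pow 3 t).div_const 3
  have h4 : HasDerivAt (fun t : ℝ => t ^ 4 / 4) (((4 : ℕ) : ℝ) * t ^ (4 - 1) / 4) t :=
    (hasDerivAt_pow 4 t).div_const 4
  have h : HasDerivAt (fun t : ℝ => 2 * (t + t ^ 2 / 2 - t ^ 3 / 3 - t ^ 4 / 4))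
      (2 * (1 + ((2 : ℕ) : ℝ) * t ^ (2 - 1) / 2 - ((3 : ℕ) : ℝ) * t ^ (3 - 1) / 3 -
        ((4 : ℕ) : ℝ) * t ^ (4 - 1) / 4)) t :=
    (((h1.fun_add h2).fun_sub h3).fun_sub h4).const_mul 2
  convert h using 1
  push_cast
  ring

/-! ## The base segment `[-1, 1] ⊆ ℝ¹` -/

/-- `[-1, 1] ⊆ ℝ¹` (the projection of the disc to the `x`-axis) is `ℚ`-semialgebraic: two
polynomial inequalities. [folklore] -/
theorem weightConst_isSemialgebraic_seg :
    IsSemialgebraic ℚ {x : Fin 1 → ℝ | -1 ≤ x 0 ∧ x 0 ≤ 1} := by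
  have h1 := isSemialgebraic_setOf_eval_nonneg (k := ℚ) (R := ℝ)
    (X 0 + 1 : MvPolynomial (Fin 1) ℚ)
  have h2 := isSemialgebraic_setOf_eval_nonneg (k := ℚ) (R := ℝ)
    (1 - X 0 : MvPolynomial (Fin 1) ℚ)
  have h := h1.inter h2
  simp only [map_add, map_sub, map_one, MvPolynomial.aeval_X] at h
  have hset : {x : Fin 1 → ℝ | -1 ≤ x 0 ∧ x 0 ≤ 1} =
      {x : Fin 1 → ℝ | 0 ≤ x 0 + 1} ∩ {x | 0 ≤ 1 - x 0} := by
    ext x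
    simp only [mem_inter_iff, mem_setOf_eq]
    constructor
    · rintro ⟨h1, h2⟩
      exact ⟨by linarith, by linarith⟩
    · rintro ⟨h1, h2⟩
      exact ⟨by linarith, by linarith⟩
  rw [hset]
  exact h

/-- `[-1, 1] ⊆ ℝ¹` is compact (it is the closed box `Icc (-1) 1`). [folklore] -/
theorem weightConst_isCompact_seg : IsCompact {x : Fin 1 → ℝ | -1 ≤ x 0 ∧ x 0 ≤ 1} := by
  have hset : {x : Fin 1 → ℝ | -1 ≤ x 0 ∧ x 0 ≤ 1} =
      Icc (fun _ : Fin 1 => (-1 : ℝ)) (fun _ => 1) := by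
    ext x
    simp only [mem_setOf_eq, mem_Icc, Pi.le_def, Fin.forall_fin_one]
  rw [hset]
  exact isCompact_Icc

/-- The upper edge `x ↦ √(1 - x²)` of the disc is `ℚ`-semialgebraic on the base segment (the
square root of a polynomial over `ℚ`). [folklore] -/
theorem weightConst_isSemialgebraicFunOn_edge :
    IsSemialgebraicFunOn ℚ {x : Fin 1 → ℝ | -1 ≤ x 0 ∧ x 0 ≤ 1}
      (fun x => Real.sqrt (1 - x 0 ^ 2)) :=
  (IsSemialgebraicFunOn.sqrt_holds (isSemialgebraicFunOn_aeval weightConst_isSemialgebraic_seg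
    (1 - X 0 ^ 2 : MvPolynomial (Fin 1) ℚ))).congr fun x _ => by simp

/-- The kernel `k x = 2(1 + x)(1 - x²)` (the integral of the weight over the fibre of the disc
over `x`) is `ℚ`-semialgebraic on the base segment (a polynomial over `ℚ`). [folklore] -/
theorem weightConst_isSemialgebraicFunOn_ker :
    IsSemialgebraicFunOn ℚ {x : Fin 1 → ℝ | -1 ≤ x 0 ∧ x 0 ≤ 1}
      (fun x => 2 * (1 + x 0) * (1 - x 0 ^ 2)) :=
  (isSemialgebraicFunOn_aeval weightConst_isSemialgebraic_seg
    (2 * (1 + X 0) * (1 - X 0 ^ 2) : MvPolynomial (Fin 1) ℚ)).congr fun x _ => by simp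

/-- The primitive `P x = 2(x + x²/2 - x³/3 - x⁴/4)` of the kernel is `ℚ`-semialgebraic on the
base segment (a polynomial over `ℚ`). [folklore] -/
theorem weightConst_isSemialgebraicFunOn_prim :
    IsSemialgebraicFunOn ℚ {x : Fin 1 → ℝ | -1 ≤ x 0 ∧ x 0 ≤ 1}
      (fun x => 2 * (x 0 + x 0 ^ 2 / 2 - x 0 ^ 3 / 3 - x 0 ^ 4 / 4)) :=
  (isSemialgebraicFunOn_aeval weightConst_isSemialgebraic_seg
    (2 * (X 0 + C (1 / 2 : ℚ) * X 0 ^ 2 - C (1 / 3 : ℚ) * X 0 ^ 3 - C (1 / 4 : ℚ) * X 0 ^ 4) :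
      MvPolynomial (Fin 1) ℚ)).congr fun x _ => by
    simp only [map_mul, map_sub, map_add, map_pow, map_ofNat, MvPolynomial.aeval_X,
      MvPolynomial.aeval_C, eq_ratCast]
    push_cast
    ring

/-- The kernel is absolutely integrable on the base segment (continuous on a compact set).
[folklore] -/
theorem weightConst_integrableOn_ker :
    IntegrableOn (fun x : Fin 1 → ℝ => 2 * (1 + x 0) * (1 - x 0 ^ 2))
      {x : Fin 1 → ℝ | -1 ≤ x 0 ∧ x 0 ≤ 1} :=
  (Continuous.continuousOn (by fun_prop)).integrableOn_compact weightConst_isCompact_seg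

/-- The primitive is absolutely integrable on the base segment (continuous on a compact set).
[folklore] -/
theorem weightConst_integrableOn_prim :
    IntegrableOn (fun x : Fin 1 → ℝ => 2 * (x 0 + x 0 ^ 2 / 2 - x 0 ^ 3 / 3 - x 0 ^ 4 / 4))
      {x : Fin 1 → ℝ | -1 ≤ x 0 ∧ x 0 ≤ 1} :=
  (Continuous.continuousOn (by fun_prop)).integrableOn_compact weightConst_isCompact_seg

/-! ## The weighted disc -/

/-- The closed unit disc lies in the square `[-1, 1]²`. [folklore] -/
theorem weightConst_piDisc_subset_Icc :
    piDisc ⊆ Icc (fun _ : Fin 2 => (-1 : ℝ)) (fun _ => 1) := by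
  intro z hz
  rw [mem_piDisc] at hz
  have h0 : z 0 ^ 2 ≤ 1 ^ 2 := by nlinarith [sq_nonneg (z 1)]
  have h1 : z 1 ^ 2 ≤ 1 ^ 2 := by nlinarith [sq_nonneg (z 0)]
  have h0' := abs_le_of_sq_le_sq' h0 zero_le_one
  have h1' := abs_le_of_sq_le_sq' h1 zero_le_one
  simp only [mem_Icc, Pi.le_def, Fin.forall_fin_two]
  exact ⟨⟨h0'.1, h1'.1⟩, h0'.2, h1'.2⟩

/-- The closed unit disc is compact (a closed subset of the square `[-1, 1]²`). [folklore] -/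
theorem weightConst_isCompact_piDisc : IsCompact piDisc :=
  isCompact_Icc.of_isClosed_subset (isClosed_le (by fun_prop) continuous_const)
    weightConst_piDisc_subset_Icc

/-- The weight `(x, y) ↦ (1 + x)√(1 - x²)` is `ℚ`-semialgebraic on the closed unit disc (a
polynomial times the square root of a polynomial; Tarski–Seidenberg). [folklore] -/
theorem weightConst_isSemialgebraicFunOn_weight :
    IsSemialgebraicFunOn ℚ piDisc (fun z : Fin 2 → ℝ => (1 + z 0) * Real.sqrt (1 - z 0 ^ 2)) :=
  (IsSemialgebraicFunOn.mul_holds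
    (isSemialgebraicFunOn_aeval isSemialgebraic_piDisc (1 + X 0 : MvPolynomial (Fin 2) ℚ))
    (IsSemialgebraicFunOn.sqrt_holds (isSemialgebraicFunOn_aeval isSemialgebraic_piDisc
      (1 - X 0 ^ 2 : MvPolynomial (Fin 2) ℚ)))).congr fun z _ => by simp

/-- The primitive `(x, y) ↦ y · (1 + x)√(1 - x²)` of move 1 is `ℚ`-semialgebraic on the closed
unit disc (a coordinate times the weight). [folklore] -/
theorem weightConst_isSemialgebraicFunOn_primDisc :
    IsSemialgebraicFunOn ℚ piDisc
      (fun z : Fin 2 → ℝ => z (Fin.last 1) * ((1 + z 0) * Real.sqrt (1 - z 0 ^ 2))) :=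
  (IsSemialgebraicFunOn.mul_holds
    (isSemialgebraicFunOn_aeval isSemialgebraic_piDisc (X (Fin.last 1) : MvPolynomial (Fin 2) ℚ))
    weightConst_isSemialgebraicFunOn_weight).congr fun z _ => by simp

/-- The weight is absolutely integrable on the closed unit disc (continuous on a compact set).
[folklore] -/
theorem weightConst_integrableOn_weight :
    IntegrableOn (fun z : Fin 2 → ℝ => (1 + z 0) * Real.sqrt (1 - z 0 ^ 2)) piDisc :=
  (Continuous.continuousOn (by fun_prop)).integrableOn_compact weightConst_isCompact_piDisc

/-! ## Move 1: `D_w ∼ [[-1, 1], k]` (Newton–Leibniz in dimension `2 → 1`) -/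

/-- **`D_w − [[-1, 1], 2(1 + x)(1 - x²)]` is one Newton–Leibniz move** (for any representations
`D`, `K` with these domains and integrands): base `[-1, 1]`, edges
`a x = -√(1 - x²) ≤ b x = √(1 - x²)`, primitive `F (x, y) = y · (1 + x)√(1 - x²)`
(`∂F/∂y = (1 + x)√(1 - x²)`, `F (x, b x) - F (x, a x) = 2(1 + x)(1 - x²)`).
[cite: KontsevichZagier2001, §1.2 rule (3)] -/
theorem weightConst_of_sub_of_mem_newtonLeibnizRel_of_disc (D : IntegralRep 2) (K : IntegralRep 1)
    (hDd : D.domain = piDisc)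
    (hDi : D.integrand = fun z => (1 + z 0) * Real.sqrt (1 - z 0 ^ 2))
    (hKd : K.domain = {x : Fin 1 → ℝ | -1 ≤ x 0 ∧ x 0 ≤ 1})
    (hKi : K.integrand = fun x => 2 * (1 + x 0) * (1 - x 0 ^ 2)) :
    of D - of K ∈ newtonLeibnizRel := by
  refine ⟨1, D, K, fun x => -Real.sqrt (1 - x 0 ^ 2), fun x => Real.sqrt (1 - x 0 ^ 2),
    fun z => z (Fin.last 1) * ((1 + z 0) * Real.sqrt (1 - z 0 ^ 2)), ?_, ?_, ?_, ?_, ?_, ?_, ?_,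
    ?_, rfl⟩
  · -- `F (x, y) = y · w (x)` is semialgebraic on the disc
    rw [hDd]
    exact weightConst_isSemialgebraicFunOn_primDisc
  · -- the lower edge `a = -b`
    rw [hKd]
    exact weightConst_isSemialgebraicFunOn_edge.neg
  · -- the upper edge `b`
    rw [hKd]
    exact weightConst_isSemialgebraicFunOn_edge
  · -- `a ≤ b` on the base
    intro x _
    have hu := Real.sqrt_nonneg (1 - x 0 ^ 2)
    linarith
  · -- the disc is the band `{a x ≤ y ≤ b x}` over the base segment
    rw [hDd, hKd]
    ext z
    have e0 : Fin.init z 0 = z 0 := rfl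
    have e1 : z (Fin.last 1) = z 1 := rfl
    simp only [mem_piDisc, mem_setOf_eq, e0, e1]
    constructor
    · intro h
      have h0 : z 0 ^ 2 ≤ 1 ^ 2 := by nlinarith [sq_nonneg (z 1)]
      have hnn : 0 ≤ 1 - z 0 ^ 2 := by nlinarith [sq_nonneg (z 1)]
      have h4 : z 1 ^ 2 ≤ Real.sqrt (1 - z 0 ^ 2) ^ 2 := by
        rw [Real.sq_sqrt hnn]
        linarith
      exact ⟨abs_le_of_sq_le_sq' h0 zero_le_one, abs_le_of_sq_le_sq' h4 (Real.sqrt_nonneg _)⟩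
    · rintro ⟨⟨h1, h2⟩, h3, h4⟩
      have hnn : 0 ≤ 1 - z 0 ^ 2 := by nlinarith
      have h5 := sq_le_sq' h3 h4
      rw [Real.sq_sqrt hnn] at h5
      linarith
  · -- continuity of `y ↦ F (x, y) = y · w (x)` on the closed fibre
    intro x _
    simp only [Fin.snoc_last, Fin.snoc_apply_zero]
    fun_prop
  · -- `∂F/∂y = w (x)` is the integrand of `D_w`
    intro x _ t _
    have h : HasDerivAt (fun s : ℝ => s * ((1 + x 0) * Real.sqrt (1 - x 0 ^ 2)))
        (1 * ((1 + x 0) * Real.sqrt (1 - x 0 ^ 2))) t := (hasDerivAt_id' t).mul_const _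
    rw [one_mul] at h
    simpa only [Fin.snoc_last, Fin.snoc_apply_zero, hDi] using h
  · -- the boundary term is the kernel: `b x · w (x) - a x · w (x) = 2(1 + x)(√(1 - x²))²`
    intro x hx
    rw [hKd] at hx
    have h := Real.mul_self_sqrt (show (0 : ℝ) ≤ 1 - x 0 ^ 2 by nlinarith [hx.1, hx.2])
    simp only [Fin.snoc_last, Fin.snoc_apply_zero, hKi]
    linear_combination (-2 * (1 + x 0)) * h

/-! ## Move 2: `s × [[-1, 1], k] ∼ [σ, (8/3)·f]` (Newton–Leibniz in dimension `m + 1 → m`) -/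

/-- **`s × [[-1, 1], k] − [σ, (8/3)·f]` is one Newton–Leibniz move** over the arbitrary base
`s = [σ, f]` (for any representations `K = [[-1, 1], k]`, `P = [[-1, 1], P]` with these domains
and integrands): constant edges `-1 ≤ 1`, primitive `F = f ⊗ P`,
`P x = 2(x + x²/2 - x³/3 - x⁴/4)`, `P 1 - P (-1) = 8/3`.
[cite: KontsevichZagier2001, §1.2 rule (3)] -/
theorem weightConst_of_prod_sub_of_constMul_mem_newtonLeibnizRel {m : ℕ} (s : IntegralRep m)
    (K P : IntegralRep 1) (hKd : K.domain = {x : Fin 1 → ℝ | -1 ≤ x 0 ∧ x 0 ≤ 1})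
    (hKi : K.integrand = fun x => 2 * (1 + x 0) * (1 - x 0 ^ 2))
    (hPd : P.domain = {x : Fin 1 → ℝ | -1 ≤ x 0 ∧ x 0 ≤ 1})
    (hPi : P.integrand = fun x => 2 * (x 0 + x 0 ^ 2 / 2 - x 0 ^ 3 / 3 - x 0 ^ 4 / 4))
    (ha : IsAlgebraic ℚ (8 / 3 : ℝ)) :
    of (s.prod K) - of (s.constMul (8 / 3) ha) ∈ newtonLeibnizRel := by
  have hdom : (s.prod K).domain = (s.prod P).domain := by
    ext z
    simp only [IntegralRep.prod_domain, IntegralRep.mem_prodDomain, hKd, hPd]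
  refine ⟨m, s.prod K, s.constMul (8 / 3) ha, fun _ => (-1 : ℝ), fun _ => (1 : ℝ),
    (s.prod P).integrand, ?_, ?_, ?_, fun _ _ => by norm_num, ?_, ?_, ?_, ?_, rfl⟩
  · -- `F = f ⊗ P` is the integrand of a product representation, hence semialgebraic
    rw [hdom]
    exact (s.prod P).isSemialgebraicFunOn_integrand
  · -- `a = -1` is semialgebraic on `σ`
    exact (isSemialgebraicFunOn_aeval s.isSemialgebraic_domain
      (-1 : MvPolynomial (Fin m) ℚ)).congr fun x _ => by simp
  · -- `b = 1` is semialgebraic on `σ`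
    exact (isSemialgebraicFunOn_aeval s.isSemialgebraic_domain
      (1 : MvPolynomial (Fin m) ℚ)).congr fun x _ => by simp
  · -- `σ × [-1, 1]` is the band with constant edges over `σ`
    ext z
    simp only [IntegralRep.prod_domain, IntegralRep.mem_prodDomain, hKd,
      IntegralRep.domain_constMul, mem_setOf_eq, init_eq_comp_castAdd, natAdd_zero_eq_last]
  · -- continuity of `t ↦ f x · P t` on the closed fibre
    intro x _
    simp only [prod_integrand_snoc, hPi]
    fun_prop
  · -- `∂/∂t (f x · P t) = f x · k t`
    intro x _ t _
    have hF : (fun t : ℝ => (s.prod P).integrand (Fin.snoc x t)) =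
        fun t => s.integrand x * (2 * (t + t ^ 2 / 2 - t ^ 3 / 3 - t ^ 4 / 4)) := by
      funext t
      simp only [prod_integrand_snoc, hPi]
    have hk : (s.prod K).integrand (Fin.snoc x t) =
        s.integrand x * (2 * (1 + t) * (1 - t ^ 2)) := by
      simp only [prod_integrand_snoc, hKi]
    rw [hF, hk]
    exact (weightConst_hasDerivAt_prim t).const_mul (s.integrand x)
  · -- the boundary term: `(8/3) f x = f x · P 1 - f x · P (-1)`
    intro x _
    simp only [prod_integrand_snoc, hPi, IntegralRep.integrand_constMul]
    ring

/-! ## The stub -/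

/-- **STUB `stub_weightConst`** (registered stub of the `dirichlet-companion-to-pi` skeleton of
crux `BetaCancellation`): the weighted closed unit disc `D_w = [{x² + y² ≤ 1}, (1 + x)√(1 - x²)]`
is worth `8/3` against any factor: `s × D_w ∼ [σ, (8/3)·f]` for every representation
`s = [σ, f]` (`∫_{-1}^{1} 2(1 + x)(1 - x²) dx = 8/3`). [folklore] -/
theorem stub_weightConst :
    ∃ Dw : IntegralRep 2, Dw.domain = piDisc ∧
      (Dw.integrand = fun z => (1 + z 0) * Real.sqrt (1 - z 0 ^ 2)) ∧
      ∀ (ha : IsAlgebraic ℚ (8 / 3 : ℝ)) (m : ℕ) (s : IntegralRep m),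
        Equivalent (s.prod Dw) (s.constMul (8 / 3) ha) :=
  let Dw : IntegralRep 2 :=
    ⟨piDisc, fun z => (1 + z 0) * Real.sqrt (1 - z 0 ^ 2), isSemialgebraic_piDisc,
      weightConst_isSemialgebraicFunOn_weight, weightConst_integrableOn_weight⟩
  let K : IntegralRep 1 :=
    ⟨{x : Fin 1 → ℝ | -1 ≤ x 0 ∧ x 0 ≤ 1}, fun x => 2 * (1 + x 0) * (1 - x 0 ^ 2),
      weightConst_isSemialgebraic_seg, weightConst_isSemialgebraicFunOn_ker,
      weightConst_integrableOn_ker⟩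
  let P : IntegralRep 1 :=
    ⟨{x : Fin 1 → ℝ | -1 ≤ x 0 ∧ x 0 ≤ 1},
      fun x => 2 * (x 0 + x 0 ^ 2 / 2 - x 0 ^ 3 / 3 - x 0 ^ 4 / 4),
      weightConst_isSemialgebraic_seg, weightConst_isSemialgebraicFunOn_prim,
      weightConst_integrableOn_prim⟩
  ⟨Dw, rfl, rfl, fun ha _ s =>
    (Equivalent.prod (Equivalent.refl s) (newtonLeibnizRel_subset_relations
      (weightConst_of_sub_of_mem_newtonLeibnizRel_of_disc Dw K rfl rfl rfl rfl))).trans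
      (newtonLeibnizRel_subset_relations
        (weightConst_of_prod_sub_of_constMul_mem_newtonLeibnizRel s K P rfl rfl rfl rfl ha))⟩

end Summit.KontsevichZagierPeriods.KontsevichZagierPeriods.BetaCancellationLine
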